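import Summits.ValiantsHypothesis.ValiantsHypothesis.Theorems.BarrierLeverDefinableEquationsUnipotentInvariants
import Summits.ValiantsHypothesis.ValiantsHypothesis.Theorems.BarrierLeverDefinableEquationsIsobaric

/-!
# Cruxes `BarrierLever.DefinableEquations` (stmt-ValiantsHypothesis-8745) / `SingleSizeEquations`
# (8749) — NORMAL FORM: the witness may be taken INVARIANT UNDER THE UNIPOTENT RADICAL

Sixth file of the "U-half" of the normal-form programme (design memo `HWV-NORMAL-FORM-PLAN.md`,
evidence #9 on stmt-ValiantsHypothesis-8749); assembles `…UnipotentAction/Elementary/Coefficients/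
LeadingForm/Invariants.lean`.

THEOREM (`uEq_of_eq`, pointwise; `definableEquations_iff_uInvariant`,
`singleSizeEquations_iff_uInvariant`).  Write `Eq(n, b, a)` for the inner statement of the crux (a
nonzero level-`a` Boolean sum `E = boolSum H` in the `N = C(2n,n)` coefficient variables vanishing
at `coeff f` for every `f ∈ SmallCircuits ℂ n b`).  Then `Eq(n, b+3, a) → UEq(n, b, a+4)` for
`n ≥ 64`, `n ≥ 2a + 6`, where `UEq` adds: `E(coeff(f ∘ u_t)) = E(coeff f)` for every upper
unitriangular substitution `u_t : x_j ↦ x_j + Σ_{i<j} t_ij x_i` and every `f` of degree `≤ n` —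
`E` is INVARIANT under the unipotent radical `U_n` of the Borel subgroup acting on
`Sym^{≤n}(ℂ^n)^*`.  Consequently `DefinableEquations ↔ ∃ a ∀ b ∃ n₀ ∀ n ≥ n₀, UEq(n, b, a)` and the
same for the `∀ b ∃ a` item `SingleSizeEquations`.

PROOF.  `G(s, c) := E(T_s c)` is a Boolean sum of level `a + O(1)` in `(s, c)`
(`…UnipotentCoefficients.lean`); its top ROOT-HEIGHT component `G_top` is again a Boolean sum (the
Fourier extraction `exists_boolSum_eq_weightedHomogeneousComponent` of `…BoolSumFourier.lean`, `N`
new Boolean variables), is nonzero (`G(0, c) = E(c)`), vanishes at `(s, coeff f)` for all `s` and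
all `f ∈ SmallCircuits ℂ n b` (all translates `f ∘ u_s` lie in `SmallCircuits ℂ n (b+3)`,
`…UnipotentTranslates.lean`, and components of a polynomial vanishing on a torus orbit vanish), and
satisfies `G_top(s, T_t c) = G_top(s, c)` (`…UnipotentInvariants.lean`).  Specialising `s := s₀`
with `G_top(s₀, ·) ≠ 0` gives the witness.  Levels: `q ↦ q + N`, size `+ n² N(n+1)(n+3) +
(n² + N)(3N+1) + 3N + 2`, degree `× (1 + n³)(N + 1) + N`, all `≤ N^(a+4)` (`u_level_arith`).

WHY (honest framing).  Together with the torus normal form (`…Isobaric/WeightVector.lean`) this is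
the Borel half of "WLOG the witness is a highest weight vector"; the combination is
`…HighestWeightVector.lean`.  It does NOT touch the open content of the crux (Chatterjee–Tengse
2023 §1.3 dir. 2), 8746, 14610 or VP vs VNP.  No definitions, no named facts.  References:
[LandsbergGCT2017] §8; [ForbesShpilkaVolk2018] Def. 1; [Burgisser2000] §2.1.
-/

-- layout Summits/ValiantsHypothesis/ValiantsHypothesis forces the duplicated namespace component
set_option linter.dupNamespace false

noncomputable section

open MvPolynomial

namespace Summit.ValiantsHypothesis.ValiantsHypothesis.Theorems.BarrierLever.IsobaricEquations

open Literature.Computability.AlgebraicComplexity Literature.Barriers.ValiantsHypothesis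
open Summit.ValiantsHypothesis.ValiantsHypothesis.Theorems.BarrierLever.SuccinctHittingSetsForVP
open Summit.ValiantsHypothesis.ValiantsHypothesis.Theorems.BarrierLever.BoolSumComponents

/-! ## §8 The `U`-invariant normal form: arithmetic and the extraction theorem -/

section uarith

variable {n : ℕ}

/-- Arithmetic at `n ≥ 64`: `9 ≤ N`, `n² ≤ N`, `(n+1)(n+3) ≤ N`, `1 + n³ ≤ N` for `N = C(2n,n)`.
[folklore] -/
theorem uN_arith (hn : 64 ≤ n) :
    9 ≤ (2 * n).choose n ∧ n * n ≤ (2 * n).choose n ∧ (n + 1) * (n + 3) ≤ (2 * n).choose n ∧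
      1 + n * n * n ≤ (2 * n).choose n := by
  obtain ⟨-, hnN, hn3, -⟩ := N_arith hn
  have h1 : n * n ≤ n ^ 3 := by rw [pow_succ, pow_two]; exact Nat.le_mul_of_pos_right _ (by omega)
  have h2 : (n + 1) * (n + 3) ≤ n * n * n := by nlinarith
  have h3 : n * n * n = n ^ 3 := by ring
  have h4 : 64 * 64 * 64 ≤ n * n * n := Nat.mul_le_mul (Nat.mul_le_mul hn hn) hn
  refine ⟨by omega, by omega, by omega, by omega⟩

/-- Weighted-degree arithmetic for the root-height extraction: `N^a (1 + n³) n < 2^N` at `n ≥ 64`,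
`n ≥ 2a + 6`. [folklore] -/
theorem u_wdeg_arith {a : ℕ} (hn : 64 ≤ n) (ha : 2 * a + 6 ≤ n) :
    (2 * n).choose n ^ a * (1 + n * n * n) * n < 2 ^ (2 * n).choose n := by
  obtain ⟨h5, hnN, hn3, h4⟩ := N_arith hn
  obtain ⟨-, -, -, hcube⟩ := uN_arith hn
  set N := (2 * n).choose n with hNdef
  calc N ^ a * (1 + n * n * n) * n ≤ N ^ a * N * N :=
        Nat.mul_le_mul (Nat.mul_le_mul_left _ hcube) hnN.le
    _ = N ^ (a + 2) := by ring
    _ ≤ (4 ^ n) ^ (a + 2) := Nat.pow_le_pow_left h4 _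
    _ = 2 ^ (2 * n * (a + 2)) := by
        rw [show (4 : ℕ) = 2 ^ 2 by norm_num, ← pow_mul, ← pow_mul, mul_assoc]
    _ < 2 ^ N := Nat.pow_lt_pow_right (by norm_num) ?_
  have hq : 2 * (a + 2) ≤ n := by omega
  calc 2 * n * (a + 2) = n * (2 * (a + 2)) := by ring
    _ ≤ n * n := Nat.mul_le_mul_left n hq
    _ ≤ n * n * n := Nat.le_mul_of_pos_right _ (by omega)
    _ < N := by
        have : n * n * n = n ^ 3 := by ring
        omega

/-- Level arithmetic for the root-height extraction: the three budgets fit into `N^(a+4)`.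
[folklore] -/
theorem u_level_arith {N a q c d n : ℕ} (hN : 9 ≤ N) (h1 : n * n ≤ N) (h2 : (n + 1) * (n + 3) ≤ N)
    (h3 : 1 + n * n * n ≤ N) (hq : q ≤ N ^ a) (hc : c ≤ N ^ a) (hd : d ≤ N ^ a) :
    q + N ≤ N ^ (a + 4) ∧
      c + n * n * (N * ((n + 1) * (n + 3))) + (n * n + N) * (3 * N + 1) + 3 * N + 2 ≤ N ^ (a + 4) ∧
      d * (1 + n * n * n) * (N + 1) + N ≤ N ^ (a + 4) := by
  have hNa : 1 ≤ N ^ a := Nat.one_le_pow _ _ (by omega)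
  have hX : ∀ X : ℕ, X ≤ N ^ a * X := fun X => Nat.le_mul_of_pos_left X hNa
  have hpow : N ^ (a + 4) = N ^ a * (N * N * N * N) := by ring
  -- the power tower `N ≤ N²/9 ≤ N³/81 ≤ N⁴/729`
  have e2 : 9 * N ≤ N * N := Nat.mul_le_mul_right N hN
  have e3 : N * N * 9 ≤ N * N * N := Nat.mul_le_mul_left (N * N) hN
  have e4 : N * N * N * 9 ≤ N * N * N * N := Nat.mul_le_mul_left (N * N * N) hN
  rw [hpow]
  refine ⟨?_, ?_, ?_⟩
  · calc q + N ≤ N ^ a + N ^ a * N := Nat.add_le_add hq (hX N)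
      _ = N ^ a * (1 + N) := by ring
      _ ≤ N ^ a * (N * N * N * N) := Nat.mul_le_mul_left _ (by omega)
  · have hA : n * n * (N * ((n + 1) * (n + 3))) ≤ N * (N * N) :=
      Nat.mul_le_mul h1 (Nat.mul_le_mul_left _ h2)
    have hA' : N * (N * N) = N * N * N := by ring
    have hB : (n * n + N) * (3 * N + 1) ≤ (2 * N) * (4 * N) :=
      Nat.mul_le_mul (by omega) (by omega)
    have hB' : (2 * N) * (4 * N) = 8 * (N * N) := by ring
    rw [hA'] at hA
    rw [hB'] at hB
    have hC : 1 + (N * N * N + 8 * (N * N) + 3 * N + 2) ≤ N * N * N * N := by omega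
    calc c + n * n * (N * ((n + 1) * (n + 3))) + (n * n + N) * (3 * N + 1) + 3 * N + 2
        ≤ N ^ a + (N * N * N + 8 * (N * N) + 3 * N + 2) := by omega
      _ ≤ N ^ a + N ^ a * (N * N * N + 8 * (N * N) + 3 * N + 2) :=
          Nat.add_le_add_left (hX _) _
      _ = N ^ a * (1 + (N * N * N + 8 * (N * N) + 3 * N + 2)) := by ring
      _ ≤ N ^ a * (N * N * N * N) := Nat.mul_le_mul_left _ hC
  · have hD : d * (1 + n * n * n) * (N + 1) ≤ N ^ a * N * (N + 1) :=
      Nat.mul_le_mul_right _ (Nat.mul_le_mul hd h3)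
    have hD' : N ^ a * N * (N + 1) = N ^ a * (N * N + N) := by ring
    rw [hD'] at hD
    have hE : N * N + N + N ≤ N * N * N * N := by omega
    calc d * (1 + n * n * n) * (N + 1) + N ≤ N ^ a * (N * N + N) + N ^ a * N :=
          Nat.add_le_add hD (hX N)
      _ = N ^ a * (N * N + N + N) := by ring
      _ ≤ N ^ a * (N * N * N * N) := Nat.mul_le_mul_left _ hE

/-- `SmallCircuits` is monotone in the size exponent (`n ≥ 1`). [cite: ForbesShpilkaVolk2018, Cor. 5] -/
theorem smallCircuits_mono {b b' : ℕ} (hn : 1 ≤ n) (hb : b ≤ b') :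
    SmallCircuits ℂ n b ⊆ SmallCircuits ℂ n b' := fun _ hf =>
  ⟨hf.1, hf.2.trans (Nat.pow_le_pow_right hn hb)⟩

/-- The root heights are `≤ n`. [folklore] -/
theorem heightW_le (v : (Fin n × Fin n) ⊕ degLEMonomials n) : heightW n v ≤ n := by
  rcases v with ⟨i, j⟩ | m
  · simp only [heightW, Sum.elim_inl]; have := j.2; omega
  · simp [heightW]

end uarith

section uextract

variable {n : ℕ}

/-- **Pointwise `U`-normal form `Eq(n, b+3, a) → UEq(n, b, a+4)`** (`n ≥ 64`, `n ≥ 2a + 6`): from a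
nonzero level-`a` Boolean-sum equation against `SmallCircuits ℂ n (b+3)` one obtains a nonzero
level-`(a+4)` Boolean-sum equation against `SmallCircuits ℂ n b` which is INVARIANT under the
coefficient action of every upper unitriangular substitution: `E(T_t c) = E(c)`. [folklore] -/
theorem uEq_of_eq [Fintype (degLEMonomials n)] {a b : ℕ} (hn : 64 ≤ n) (ha : 2 * a + 6 ≤ n)
    (h : ∃ q : ℕ, q ≤ (Nat.choose (2 * n) n) ^ a ∧
      ∃ H : MvPolynomial (↥(degLEMonomials n) ⊕ Fin q) ℂ,
        complexity H ≤ (Nat.choose (2 * n) n) ^ a ∧ H.totalDegree ≤ (Nat.choose (2 * n) n) ^ a ∧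
        boolSum H ≠ 0 ∧
        ∀ f ∈ SmallCircuits ℂ n (b + 3), eval (coeffVector (degLEMonomials n) f) (boolSum H) = 0) :
    ∃ q : ℕ, q ≤ (Nat.choose (2 * n) n) ^ (a + 4) ∧
      ∃ H : MvPolynomial (↥(degLEMonomials n) ⊕ Fin q) ℂ,
        complexity H ≤ (Nat.choose (2 * n) n) ^ (a + 4) ∧
        H.totalDegree ≤ (Nat.choose (2 * n) n) ^ (a + 4) ∧ boolSum H ≠ 0 ∧
        (∀ f ∈ SmallCircuits ℂ n b, eval (coeffVector (degLEMonomials n) f) (boolSum H) = 0) ∧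
        ∀ (t : Fin n → Fin n → ℂ) (c : degLEMonomials n → ℂ),
          eval (uAct t c) (boolSum H) = eval c (boolSum H) := by
  classical
  obtain ⟨q, hq, H, hc, hd, hne, hvan⟩ := h
  obtain ⟨h5, hnN, -, -⟩ := N_arith hn
  obtain ⟨h9, hsq, h13, hcube⟩ := uN_arith hn
  set N := (2 * n).choose n with hNdef
  set E := boolSum H with hEdef
  set HG := genHomH q (pairList n) (rename (Sum.map Sum.inr id) H) with hHGdef
  set G := boolSum HG with hGdef
  have hG : ∀ (s : Fin n → Fin n → ℂ) (c : degLEMonomials n → ℂ),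
      eval (spt s c) G = eval (uAct s c) E := eval_boolSum_genTranslate H
  set D := weightedTotalDegree (heightW n) G with hDdef
  -- `G ≠ 0`, hence `G_top ≠ 0`
  have hGne : G ≠ 0 := by
    intro h0
    apply hne
    refine MvPolynomial.funext fun c => ?_
    rw [map_zero, hEdef, ← uAct_zero c, ← hG, h0, map_zero]
  have hGtop : weightedHomogeneousComponent (heightW n) D G ≠ 0 :=
    weightedHomogeneousComponent_top_ne_zero (heightW n) hGne
  -- the weighted degree is `< 2^N`
  have hK : weightedTotalDegree (heightW n) G < 2 ^ N := by
    refine (weightedTotalDegree_le (heightW n) n heightW_le G).trans_lt ?_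
    refine (Nat.mul_le_mul_right n ((totalDegree_boolSum_le HG).trans
      ((totalDegree_genTranslate_le H).trans (Nat.mul_le_mul_right _ hd)))).trans_lt ?_
    exact u_wdeg_arith hn ha
  -- Fourier extraction of the top root-height component
  obtain ⟨H', hsum', hc', hd'⟩ :=
    exists_boolSum_eq_weightedHomogeneousComponent (heightW n) HG (L := N) (J := D) hK hK
  -- specialise the `s`-variables
  obtain ⟨s₀, hs₀⟩ := exists_aeval_const_ne_zero hGtop
  obtain ⟨lq, lc, ld⟩ := u_level_arith (a := a) (q := q) (c := complexity H) (d := H.totalDegree)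
    h9 hsq h13 hcube hq hc hd
  refine ⟨q + N, lq, aeval (Sum.elim (fun v => rename Sum.inl
    ((Sum.elim (fun p => C (s₀ p)) X :
      (Fin n × Fin n) ⊕ degLEMonomials n → MvPolynomial (degLEMonomials n) ℂ) v))
    (fun j => X (Sum.inr j))) H', ?_, ?_, ?_, ?_, ?_⟩
  · -- size
    refine (complexity_aeval_le _ _).trans ?_
    have hzero : ∑ v : ((Fin n × Fin n) ⊕ degLEMonomials n) ⊕ Fin (q + N), complexity
        (Sum.elim (fun v => rename Sum.inl ((Sum.elim (fun p => C (s₀ p)) X :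
          (Fin n × Fin n) ⊕ degLEMonomials n → MvPolynomial (degLEMonomials n) ℂ) v))
          (fun j => X (Sum.inr j)) v : MvPolynomial (degLEMonomials n ⊕ Fin (q + N)) ℂ) = 0 := by
      refine Finset.sum_eq_zero fun v _ => ?_
      rcases v with (p | m) | j
      · simp only [Sum.elim_inl, rename_C]; exact complexity_C_holds _
      · simp only [Sum.elim_inl, Sum.elim_inr, rename_X]; exact complexity_X_holds _
      · simp only [Sum.elim_inr]; exact complexity_X_holds _
    rw [hzero, add_zero]
    have hcg : complexity HG ≤ complexity H + n * n * (N * ((n + 1) * (n + 3))) := by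
      have := complexity_genTranslate_le (n := n) H
      rw [card_degLEMonomials, ← hNdef] at this
      exact this
    rw [Fintype.card_sum, Fintype.card_prod, Fintype.card_fin, card_degLEMonomials, ← hNdef] at hc'
    generalize n * n * (N * ((n + 1) * (n + 3))) = A at hcg lc
    generalize (n * n + N) * (3 * N + 1) = B at hc' lc
    omega
  · -- degree
    rw [show aeval _ H' = bind₁ _ H' from rfl]
    refine (Literature.Barriers.ValiantsHypothesis.FSV2018.totalDegree_bind₁_le_mul _ 1 (fun v => ?_)
      H').trans ?_
    · rcases v with (p | m) | j
      · simp only [Sum.elim_inl, rename_C, totalDegree_C]; exact Nat.zero_le _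
      · simp only [Sum.elim_inl, Sum.elim_inr, rename_X, totalDegree_X]; exact le_rfl
      · simp only [Sum.elim_inr, totalDegree_X]; exact le_rfl
    · rw [mul_one]
      have hdg : HG.totalDegree ≤ H.totalDegree * (1 + n * n * n) := totalDegree_genTranslate_le H
      have hdg' : HG.totalDegree * (N + 1) ≤ H.totalDegree * (1 + n * n * n) * (N + 1) :=
        Nat.mul_le_mul_right _ hdg
      omega
  · -- nonzero
    rw [BoolSumComponents.boolSum_aeval_inl, hsum']
    exact hs₀
  · -- vanishing on `SmallCircuits ℂ n b`
    intro f hf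
    rw [BoolSumComponents.boolSum_aeval_inl, hsum', eval_aeval_const]
    refine eval_component_eq_zero_of_forall (fun s => ?_) _ D
    rw [hG, uAct_coeffVector s f hf.1]
    exact eval_eq_zero_of_unipotent (by omega) (b := b + 1) (by omega) hvan s
      (smallCircuits_mono (by omega) (Nat.le_succ b) hf)
  · -- `U`-invariance
    intro t c
    rw [BoolSumComponents.boolSum_aeval_inl, hsum', eval_aeval_const, eval_aeval_const]
    convert eval_top_uAct hG t (fun i j => s₀ (i, j)) c using 2

end uextract

/-! ## §9 The crux and the support item in `U`-invariant normal form -/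

section iffs

/-- **`DefinableEquations` in `U`-invariant normal form**: the crux holds iff it holds with
witnesses whose Boolean sum `E` is invariant under the unipotent radical:
`E(coeff(f ∘ u_t)) = E(coeff f)` for every upper unitriangular `u_t` and every `f` of degree `≤ n`
(one level `a` for every `b`). [cite: LandsbergGCT2017, §8] -/
theorem definableEquations_iff_uInvariant :
    Summit.ValiantsHypothesis.ValiantsHypothesis.Theses.BarrierLever.DefinableEquations ↔
      ∃ a : ℕ, ∀ b : ℕ, ∃ n₀ : ℕ, ∀ n ≥ n₀, ∃ q : ℕ, q ≤ (Nat.choose (2 * n) n) ^ a ∧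
        ∃ H : MvPolynomial (↥(degLEMonomials n) ⊕ Fin q) ℂ,
          complexity H ≤ (Nat.choose (2 * n) n) ^ a ∧ H.totalDegree ≤ (Nat.choose (2 * n) n) ^ a ∧
          boolSum H ≠ 0 ∧
          (∀ f ∈ SmallCircuits ℂ n b, eval (coeffVector (degLEMonomials n) f) (boolSum H) = 0) ∧
          ∀ (t : Fin n → Fin n → ℂ) (f : MvPolynomial (Fin n) ℂ), f.totalDegree ≤ n →
            eval (coeffVector (degLEMonomials n) (aeval (unip t) f)) (boolSum H) =
              eval (coeffVector (degLEMonomials n) f) (boolSum H) := by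
  constructor
  · rintro ⟨a, h⟩
    refine ⟨a + 4, fun b => ?_⟩
    obtain ⟨n₁, hn₁⟩ := h (b + 3)
    refine ⟨max n₁ (max 64 (2 * a + 6)), fun n hn => ?_⟩
    haveI : Fintype (degLEMonomials n) := (Finsupp.finite_of_degree_le (σ := Fin n) n).fintype
    obtain ⟨q, hq, H, hc, hd, hne, hvan, hinv⟩ :=
      uEq_of_eq (le_trans (le_max_left _ _) ((le_max_right _ _).trans hn))
        (le_trans (le_max_right _ _) ((le_max_right _ _).trans hn)) (hn₁ n ((le_max_left _ _).trans hn))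
    exact ⟨q, hq, H, hc, hd, hne, hvan, fun t f hf => eval_coeffVector_aeval_unip_of_uAct hinv t f hf⟩
  · rintro ⟨a, h⟩
    refine ⟨a, fun b => ?_⟩
    obtain ⟨n₀, hn₀⟩ := h b
    refine ⟨n₀, fun n hn => ?_⟩
    obtain ⟨q, hq, H, hc, hd, hne, hvan, -⟩ := hn₀ n hn
    exact ⟨q, hq, H, hc, hd, hne, hvan⟩

/-- **`SingleSizeEquations` in `U`-invariant normal form** (the `∀ b ∃ a` item,
stmt-ValiantsHypothesis-8749): equations at rung `b`, if they exist at all, may be taken invariant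
under the unipotent radical, at the cost of four levels. [cite: LandsbergGCT2017, §8] -/
theorem singleSizeEquations_iff_uInvariant :
    Summit.ValiantsHypothesis.ValiantsHypothesis.Theses.BarrierLever.SingleSizeEquations ↔
      ∀ b : ℕ, ∃ a n₀ : ℕ, ∀ n ≥ n₀, ∃ q : ℕ, q ≤ (Nat.choose (2 * n) n) ^ a ∧
        ∃ H : MvPolynomial (↥(degLEMonomials n) ⊕ Fin q) ℂ,
          complexity H ≤ (Nat.choose (2 * n) n) ^ a ∧ H.totalDegree ≤ (Nat.choose (2 * n) n) ^ a ∧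
          boolSum H ≠ 0 ∧
          (∀ f ∈ SmallCircuits ℂ n b, eval (coeffVector (degLEMonomials n) f) (boolSum H) = 0) ∧
          ∀ (t : Fin n → Fin n → ℂ) (f : MvPolynomial (Fin n) ℂ), f.totalDegree ≤ n →
            eval (coeffVector (degLEMonomials n) (aeval (unip t) f)) (boolSum H) =
              eval (coeffVector (degLEMonomials n) f) (boolSum H) := by
  constructor
  · intro h b
    obtain ⟨a, n₁, hn₁⟩ := h (b + 3)
    refine ⟨a + 4, max n₁ (max 64 (2 * a + 6)), fun n hn => ?_⟩
    haveI : Fintype (degLEMonomials n) := (Finsupp.finite_of_degree_le (σ := Fin n) n).fintype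
    obtain ⟨q, hq, H, hc, hd, hne, hvan, hinv⟩ :=
      uEq_of_eq (le_trans (le_max_left _ _) ((le_max_right _ _).trans hn))
        (le_trans (le_max_right _ _) ((le_max_right _ _).trans hn)) (hn₁ n ((le_max_left _ _).trans hn))
    exact ⟨q, hq, H, hc, hd, hne, hvan, fun t f hf => eval_coeffVector_aeval_unip_of_uAct hinv t f hf⟩
  · intro h b
    obtain ⟨a, n₀, hn₀⟩ := h b
    refine ⟨a, n₀, fun n hn => ?_⟩
    obtain ⟨q, hq, H, hc, hd, hne, hvan, -⟩ := hn₀ n hn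
    exact ⟨q, hq, H, hc, hd, hne, hvan⟩

end iffs

end Summit.ValiantsHypothesis.ValiantsHypothesis.Theorems.BarrierLever.IsobaricEquations

end
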